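import Literature.NumberTheory.GaloisRepresentations.FiniteGroupAveraging
import HarnessLib

/-!
# Continuous cochains of a compact group are locally trivial (Serre I §2.2 Prop. 8)

A continuous homogeneous cochain of a compact group `Γ` with values in a discrete `Γ`-module `M`
is a continuous map `Γ → C(Γ, … C(Γ, M))` into a discrete space, hence uniformly locally
constant; iterating, it is invariant under left multiplication by a neighbourhood `V` of `1` in
every variable (`exists_nhds_one_leftInv`).  Consequently its restriction to any subgroup
`U ⊆ V` is the constant cochain (`resolutionMap_eq_constRes`), and:

* `exists_nhds_one_res_one_eq_zero` — a `1`-cocycle restricts to `0` on every subgroup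
  `U ⊆ V`;
* `exists_nhds_one_res_two_eq_d` — a `2`-cochain restricts to a coboundary on every subgroup
  `U ⊆ V`.

This is the cochain-level content of "`H^q(G, A) = lim→ H^q(G/U, A^U)`" (Serre, *Cohomologie
galoisienne*, I §2.2 Prop. 8; Shatz II §2 Cor. of Prop. 7) in the two degrees used for
`Literature.NumberTheory.GaloisRepresentations.tsen_fieldCdLE_one_of_trdeg_eq_one`: every class
dies on a small open subgroup.

## References

* J.-P. Serre, *Cohomologie galoisienne* / *Galois Cohomology* (1997), I §2.2 Prop. 8.
  [SerreGaloisCohomology1997]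
* S. S. Shatz, *Profinite groups, arithmetic, and geometry* (1972), Ch. II §2. [Shatz1972]
-/

noncomputable section

open CategoryTheory Topology Filter

universe u

namespace Literature.NumberTheory.GaloisRepresentations

open _root_.TopRep _root_.ContRepresentation _root_.ContinuousCohomology

set_option allowUnsafeReducibility true in
attribute [local reducible] CategoryTheory.Functor.mapHomologicalComplex

section LeftInv

variable {k : Type*} [CommRing k] [TopologicalSpace k]
variable {Γ : Type u} [Group Γ] [TopologicalSpace Γ] [IsTopologicalGroup Γ]
variable {M : Type u} [AddCommGroup M] [Module k M] [TopologicalSpace M] [DiscreteTopology M]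
  [ContinuousSMul k M]
variable (ρ : ContinuousRep Γ k M)

attribute [local instance] discreteTopology_resolutionX

/-- `LeftInv ρ V n F`: the nested function `F ∈ Rₙ(M) = C(Γ, … C(Γ, M))` is invariant under left
multiplication by `V` in each of its `n` variables, at every depth. [folklore] -/
def LeftInv (V : Set Γ) : ∀ n : ℕ, resolutionX ρ.toTopRep n → Prop
  | 0, _ => True
  | n + 1, F => (∀ v ∈ V, ∀ x : Γ, (F : C(Γ, resolutionX ρ.toTopRep n)) (v * x) = F x) ∧
      ∀ x : Γ, LeftInv V n ((F : C(Γ, resolutionX ρ.toTopRep n)) x)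

/-- `LeftInv` is antitone in the set. [folklore] -/
theorem LeftInv.mono {V V' : Set Γ} (hVV' : V' ⊆ V) :
    ∀ {n : ℕ} {F : resolutionX ρ.toTopRep n}, LeftInv ρ V n F → LeftInv ρ V' n F
  | 0, _, _ => trivial
  | _ + 1, _, h => ⟨fun v hv x => h.1 v (hVV' hv) x, fun x => LeftInv.mono hVV' (h.2 x)⟩

/-- **Uniform local constancy in all variables**: every `F ∈ Rₙ(M)` is `LeftInv` for some
neighbourhood of `1` (induction on `n`: `exists_nhds_one_apply_mul_eq` for the outer variable, and
the finitely many values `F x` for the inner ones).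
[cite: SerreGaloisCohomology1997, I §2.2 Prop. 8] -/
theorem exists_nhds_one_leftInv [CompactSpace Γ] :
    ∀ (n : ℕ) (F : resolutionX ρ.toTopRep n), ∃ V ∈ 𝓝 (1 : Γ), LeftInv ρ V n F
  | 0, _ => ⟨Set.univ, univ_mem, trivial⟩
  | n + 1, F => by
    obtain ⟨V₁, hV₁, hF₁⟩ := exists_nhds_one_apply_mul_eq (F : C(Γ, resolutionX ρ.toTopRep n))
    have hfin := finite_range_of_compact_discrete (F : C(Γ, resolutionX ρ.toTopRep n))
    choose W hW hFW using fun r : resolutionX ρ.toTopRep n => exists_nhds_one_leftInv n r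
    refine ⟨V₁ ∩ ⋂ r ∈ Set.range (F : C(Γ, resolutionX ρ.toTopRep n)), W r,
      inter_mem hV₁ ((biInter_mem hfin).2 fun r _ => hW r), fun v hv x => hF₁ v hv.1 x,
      fun x => LeftInv.mono ρ (fun v hv => ?_) (hFW ((F : C(Γ, resolutionX ρ.toTopRep n)) x))⟩
    exact Set.mem_iInter₂.1 hv.2 _ ⟨x, rfl⟩

/-- The value of a nested function at `(1, …, 1)`. [folklore] -/
def evalOnes : ∀ n : ℕ, resolutionX ρ.toTopRep n → M
  | 0, m => m
  | n + 1, F => evalOnes n ((F : C(Γ, resolutionX ρ.toTopRep n)) 1)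

variable (U : Subgroup Γ)

/-- The constant nested function on a subgroup `U` with value `m`. [folklore] -/
def constRes (m : M) : ∀ n : ℕ, resolutionX (ρ.restrict (subgroupIncl U)).toTopRep n
  | 0 => m
  | n + 1 => ContinuousMap.const U (constRes m n)

/-- `constRes m (n+1) u = constRes m n`. [folklore] -/
@[simp] theorem constRes_succ_apply (m : M) (n : ℕ) (u : U) :
    (constRes ρ U m (n + 1) : C(U, resolutionX (ρ.restrict (subgroupIncl U)).toTopRep n)) u =
      constRes ρ U m n := rfl

variable {U}

/-- **Restriction of a `LeftInv` function to a small subgroup is constant**: if `F` is `LeftInv`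
for `V ⊇ U`, its restriction to `U` (Mathlib `resolutionMap` along `U ↪ Γ`) is the constant nested
function with value `F(1, …, 1)`. [folklore] -/
theorem resolutionMap_eq_constRes {V : Set Γ} (hUV : (U : Set Γ) ⊆ V) :
    ∀ (n : ℕ) (F : resolutionX ρ.toTopRep n), LeftInv ρ V n F →
      (resolutionMap (subgroupIncl U) (𝟙 ((ρ.restrict (subgroupIncl U)).toTopRep)) n).hom F =
        constRes ρ U (evalOnes ρ n F) n
  | 0, _, _ => rfl
  | n + 1, F, hF => by
    ext u : 1
    have h1 : (F : C(Γ, resolutionX ρ.toTopRep n)) (u : Γ) =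
        (F : C(Γ, resolutionX ρ.toTopRep n)) 1 := by
      rw [← mul_one (u : Γ)]
      exact hF.1 _ (hUV u.2) 1
    change (resolutionMap (subgroupIncl U) (𝟙 ((ρ.restrict (subgroupIncl U)).toTopRep)) n).hom
      ((F : C(Γ, resolutionX ρ.toTopRep n)) (u : Γ)) = constRes ρ U (evalOnes ρ n
        ((F : C(Γ, resolutionX ρ.toTopRep n)) 1)) n
    rw [h1]
    exact resolutionMap_eq_constRes hUV n _ (hF.2 1)

end LeftInv

/-! ### Degrees one and two -/

section LowDegree

variable {k : Type*} [CommRing k] [TopologicalSpace k]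
variable {Γ : Type u} [Group Γ] [TopologicalSpace Γ] [IsTopologicalGroup Γ] [CompactSpace Γ]
variable {M : Type u} [AddCommGroup M] [Module k M] [TopologicalSpace M] [DiscreteTopology M]
  [ContinuousSMul k M]
variable (ρ : ContinuousRep Γ k M)

/-- **A continuous `1`-cocycle of a compact group is trivial on a small open subgroup**: there is
a neighbourhood `V` of `1` such that the restriction of the cocycle to every subgroup `U ⊆ V`
vanishes (Serre I §2.2 Prop. 8 in degree `1`, cochain level).
[cite: SerreGaloisCohomology1997, I §2.2 Prop. 8] -/
theorem exists_nhds_one_res_one_eq_zero (a : (homogeneousCochains ρ.toTopRep).X 1)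
    (ha : (homogeneousCochains ρ.toTopRep).d 1 2 a = 0) :
    ∃ V ∈ 𝓝 (1 : Γ), ∀ U : Subgroup Γ, (U : Set Γ) ⊆ V →
      (cochainsMap (subgroupIncl U) (𝟙 ((ρ.restrict (subgroupIncl U)).toTopRep))).f 1 a = 0 := by
  obtain ⟨V, hV, hLI⟩ := exists_nhds_one_leftInv ρ 2 a.1
  refine ⟨V, hV, fun U hUV => ?_⟩
  set c : M := evalOnes ρ 2 a.1
  have hres : (((cochainsMap (subgroupIncl U) (𝟙 ((ρ.restrict (subgroupIncl U)).toTopRep))).f 1 a :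
      (homogeneousCochains (ρ.restrict (subgroupIncl U)).toTopRep).X 1) :
      resolutionX (ρ.restrict (subgroupIncl U)).toTopRep 2) = constRes ρ U c 2 :=
    resolutionMap_eq_constRes ρ hUV 2 a.1 hLI
  -- the cocycle identity at `(1, 1, 1)` forces `c = 0`
  have hc : c = 0 := by
    have h := congr(((($ha : (homogeneousCochains ρ.toTopRep).X 2) : resolutionX ρ.toTopRep 3) :
      C(Γ, C(Γ, C(Γ, M)))) 1 1 1)
    rw [cochains_d_coe, d_two_apply] at h
    change (a.1 : C(Γ, C(Γ, M))) 1 1 - (a.1 : C(Γ, C(Γ, M))) 1 1 + (a.1 : C(Γ, C(Γ, M))) 1 1 =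
      (0 : C(Γ, C(Γ, C(Γ, M)))) 1 1 1 at h
    rw [sub_self, zero_add] at h
    exact h
  apply Subtype.ext
  rw [hres, hc]
  rfl

/-- The constant `1`-cochain with an invariant value, on a subgroup `U`. [folklore] -/
def constOneCochain (U : Subgroup Γ) (c : M) (hc : ∀ u : U, ρ (u : Γ) c = c) :
    (homogeneousCochains (ρ.restrict (subgroupIncl U)).toTopRep).X 1 :=
  ⟨constRes ρ U c 2, by
    rw [mem_invariants]
    intro u
    ext x y
    rw [resolutionX_succ_ρ_apply, resolutionX_succ_ρ_apply]
    exact hc u⟩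

/-- **A continuous `2`-cochain of a compact group is a coboundary on a small open subgroup**:
there is a neighbourhood `V` of `1` such that the restriction of the cochain to every subgroup
`U ⊆ V` is the coboundary of a constant `1`-cochain (Serre I §2.2 Prop. 8 in degree `2`, cochain
level). [cite: SerreGaloisCohomology1997, I §2.2 Prop. 8] -/
theorem exists_nhds_one_res_two_eq_d (a : (homogeneousCochains ρ.toTopRep).X 2) :
    ∃ V ∈ 𝓝 (1 : Γ), ∀ U : Subgroup Γ, (U : Set Γ) ⊆ V →
      ∃ b : (homogeneousCochains (ρ.restrict (subgroupIncl U)).toTopRep).X 1,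
        (homogeneousCochains (ρ.restrict (subgroupIncl U)).toTopRep).d 1 2 b =
          (cochainsMap (subgroupIncl U) (𝟙 ((ρ.restrict (subgroupIncl U)).toTopRep))).f 2 a := by
  obtain ⟨V, hV, hLI⟩ := exists_nhds_one_leftInv ρ 3 a.1
  set c : M := evalOnes ρ 3 a.1
  refine ⟨V ∩ {t : Γ | ρ t c = c}, inter_mem hV (ρ.setOf_apply_eq_mem_nhds_one c), fun U hUV => ?_⟩
  have hres : (((cochainsMap (subgroupIncl U) (𝟙 ((ρ.restrict (subgroupIncl U)).toTopRep))).f 2 a :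
      (homogeneousCochains (ρ.restrict (subgroupIncl U)).toTopRep).X 2) :
      resolutionX (ρ.restrict (subgroupIncl U)).toTopRep 3) = constRes ρ U c 3 :=
    resolutionMap_eq_constRes ρ (fun t ht => (hUV ht).1) 3 a.1 hLI
  refine ⟨constOneCochain ρ U c fun u => (hUV u.2).2, Subtype.ext ?_⟩
  rw [cochains_d_coe, hres]
  ext x y z
  rw [d_two_apply]
  change c - c + c = c
  rw [sub_self, zero_add]

end LowDegree

end Literature.NumberTheory.GaloisRepresentations

end
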